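import Summits.QuantumFields.BalabanUV.Beta.WardLocusRecursiveAll
import Summits.QuantumFields.BalabanUV.Beta.GAN24.Lin4Additive

/-!
# `BalabanUV.Beta.GAN24.WardResidualSRecursion` — binder row G-an2-4 / (CONV-C), CT-W route of record «WC-TL» (RULINGS R-gan24p1-g24-1 and R-gan24p1-g24-2), located crux (Q-R):
# **THE WARD-LOCUS RESIDUAL TOWER IN S-STEP FORM.**  The residual `Nr j` of the all-levels Ward kernel law of the W-literal `WrecAt j` (D1 swarm, leaf-06:
# `WardLocusRecursiveLetters.exists_kernelLaws_of_letters`, `Nr := Nat.rec N0 NS`, classes `∃ C δ` PER LEVEL) is, at every level, a CHAIN-RULE VERTEX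
# `vertexOfK G_j Lc (Φ_j y)` of ONE first-order-type table family `Φ_j` PLUS explicit first-order data `Ψ_j`, and `Φ` runs THE S-STEP of `SpineRooted.SpureRecAt_succ`
# (pin `cE = Lc^{d+1}`) with a BLOCK-SUMMED PASSIVE LABEL: `Φ_{j+1} Y κ′u′ = Σ_{v ∈ box} (Lc^{d+1}·wE (j+1)) • e3OfK Lc G_j (Φ_j (Lc•Y+v)) κ′u′ + σ_j Y κ′u′`
# (road-P2 chair `b2b-balaban-gan24-p2`, gen 37 — p2's first refusal «an S-step-driven remainder tower» under RULING R-gan24p1-g24-1 (iii) ∕ -2 (i), exercised;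
# INTENT journal 2026-08-22T03:12Z).

NOT IN PRINT; OUR BOOKKEEPING ([folklore] kernel algebra over the D1 swarm's parts A∕C BY NAME — `WardLocusQuarticTable.tableLaw_T2RecAt_succ ∕ ''`,
`WardLocusRecursiveAll.divW_WrecAt_succ_of_kernelLaw` — hypotheses VERBATIM; nothing of theirs restated, only rewritten under `rw`).  HONEST FRAMING (cell contract,
verbatim): «discharging `BetaPertH` makes Bałaban's UV stability UNCONDITIONAL — a real constructive-QFT result; it is NOT the continuum limit and NOT the Clay problem.»
HONEST DEPENDENCY (verbatim): «continuum YM on T⁴ ⇐ BetaPertH ∧ nine spine estimates (0/9 proved); BetaPertH ⇐ (D1) ∧ (D4) ∧ CAP+tail; G-an2-4 gates asym, D1 and NE2/3/4.»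
No cited fact, no `def`, no `def … : Prop`, 0 sorry; instantiates NO binder of the β-function wall.

WHY (the OWNER gan24-p1 g24, `CT-W-DESIGN-v2.md` §4∕§6, W-10): «T2Shape»(E) ⟸ … ∧ (Q-R) «ONE `(C, δ)` for all `j` in units for the Ward-locus remainders» ⟸ uniform letters ∧
a j-uniform one-step row for the block-summed S-step ∧ an induction socket ∧ (if the rate is not < 1) the first-order charge pin.  This file is the ALGEBRAIC TRUNK: at the
typed level the recursion is carried ENTIRELY by the S-step — the only object multiplying a previous-level remainder is `(Lc^{d+1}·wE (j+1)) • e3OfK Lc G_j` (no member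
`T̃_j`, no other `O(1)·R`: refuter's K-TL-1 located) — so (Q-R) ⟺ (Q-Φ) «`∃ C δ, ∀ j Y`, unit-currency rows of `Φ_j Y`» + one-step (non-accumulating) rows of `Ψ_j`, `σ_j`
from (hS) ✓ (`GAN24.SrecAtSlotRowsFinal`), `vertexFamily_M1At` and the letters: S-slot technology (idea-1's WARD5 «Z0-IRR» rows and leaf-03's `E3SlotDivergence` start here).
* §1 bricks: `mmRead_sandwich_vertexOfK` (`mmRead N (K ∘ vertexOfK K N S κ u ∘ K) = −e3OfK N K S κ u`), `sandwich_add ∕ _smul`, `dM_add_left`.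
* §2 **`transport_vertexForm`**: for `𝒩 y = vertexOfK K N (Φ y) + Ψ y`, `c • Σ_v mmRead N (K ∘ 𝒩 (N•Y+v) κ u ∘ K) = Σ_v (−c) • e3OfK N K (Φ (N•Y+v)) κ u + c • Σ_v mmRead N (K ∘ Ψ … ∘ K)`.
* §3 **`residual_eq_vertexForm ∕ ₀`**: the displayed residual shapes of parts B∕C ARE `vertexOfK K N (A + ½ • (B₁ + B₂)) + (vertexOfM K N M′ + ½ • (h − g))`.
* §4 THE COMB INSTANCES (hW Ward pin, in-block root, `cE₂ = Lc^{2(d+1)}`): **`tableLaw_T2RecAt_succ_sstep`** — part A §3 (first slot; the `''` twin is in `WardResidualSRecursionAll`), with the level-(j+1) remainder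
  DISPLAYED as `Σ_v (Lc^{d+1}·wE (j+1)) • e3OfK Lc G_j (Φ (Lc•Y+v)) κ′u′ + σ Y κ′u′` (lock `lock_succ_of_pin ∕ lock_cancel`); **`divW_WrecAt_succ_vertexForm`** — part C §2 with the
  level-(j+1) residual DISPLAYED as `vertexOfK G_{j+1} Lc (Φ′ y) + Ψ′ y`, `Φ′ = blockSstep Φ + σ`, `Ψ′` = level-(j+1) first-order data only: THE RECURSION CLOSES ON ONE TABLE.
Asserts NO bound uniform in `j`; discharges NOTHING of (Q-R) ∕ (Q-Φ) ∕ (C) ∕ «T2Shape» ∕ «T2Drift» ∕ (hW, hWall); NEVER «G-an2-4 closed» as (CONV-C); NOT D1, NOT BetaPertH,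
NOT continuum, NOT Clay.  Unit `b2b-balaban-gan24-p2` (gen 37), 2026-08-22; no existing file touched.
-/

noncomputable section

open Finset
open scoped BigOperators
open Literature.MathematicalPhysics.QuantumFieldTheory
open Literature.MathematicalPhysics.QuantumFieldTheory.Balaban1983to89
open Literature.MathematicalPhysics.QuantumFieldTheory.Balaban1983to89.Beta
open ExpKernelCalculus (MKer Decays comp)
open KernelWard (Bdd divV divW)
open AffineAveraging (Site box toSite)
open OneStepResolventKernel (Fib wsum LocStencil)
open OneStepKernelFamily (KInvStep colH vertexOfK)
open InterLevelTransport (cwsum)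
open BalabanStepJetsSucc (mmRead wE wVH)
open SecondOrderResponse (colM vertexOfM dM LocStencilFM)
open BalabanCompositeJets (LocStencil₂)
open BalabanStepW2 (M2Of wV4 wB2)
open AveragingHessianKernelsRooted (vhSAt)
open Summit.QuantumFields.BalabanUV.Beta.TameKernelCalculus
open Summit.QuantumFields.BalabanUV.Beta.ChartConjugation (conjV)
open Summit.QuantumFields.BalabanUV.Beta.ChartConjugationReflection (vertexOfK_add)
open Summit.QuantumFields.BalabanUV.Beta.BorderedHessian (diagK stepScale)
open Summit.QuantumFields.BalabanUV.Beta.AveragingWardRootedStencils (legInd)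
open Summit.QuantumFields.BalabanUV.Beta.AxialDressingRooted (coDressKBmAt decays_coDressKBmAt_KInvStep)
open Summit.QuantumFields.BalabanUV.Beta.SpineRooted (SpureRecAt M1At T2RecAt WrecAt e3OfK e3OfK_apply)
open Summit.QuantumFields.BalabanUV.Beta.KernelWardRelative (gaugeWt)
open Summit.QuantumFields.BalabanUV.Beta.KernelWardCoarseExchange (comp_add_of_bdd add_comp_of_bdd)
open Summit.QuantumFields.BalabanUV.Beta.VertexReflectionContact (mmRead_add mmRead_neg)
open Summit.QuantumFields.BalabanUV.Beta.SecondOrderUnits (vertexOfK_smul_table)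
open Summit.QuantumFields.BalabanUV.Beta.GAN24.ThirdJetKernel (mmRead_smul)
open Summit.QuantumFields.BalabanUV.Beta.GAN24.Lin4Additive (abs_vertexOfK_le bdd_comp_decays_bdd)
open Summit.QuantumFields.BalabanUV.Beta.WardLocusQuarticTable (tableLaw_T2RecAt_succ lock_succ_of_pin)
open Summit.QuantumFields.BalabanUV.Beta.WardLocusRecursiveAll (divW_WrecAt_succ_of_kernelLaw)

namespace Summit.QuantumFields.BalabanUV.Beta.GAN24.WardResidualSRecursion

variable {d : ℕ}

/-! ## §1 Generic bricks: the sandwich of a vertex IS the S-step; the sandwich and `dM` are linear -/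

/-- [folklore] **THE TWO-SIDED SANDWICH OF A CHAIN-RULE VERTEX IS (MINUS) THE S-STEP**: `mmRead N (K ∘ vertexOfK K N S κ u ∘ K) = −e3OfK N K S κ u`
(`SpineRooted.e3OfK_apply` of `ValueJetGeneric`, which DEFINES `e3OfK` as minus this sandwich). -/
theorem mmRead_sandwich_vertexOfK (N : ℕ) (K : MKer (d + 1) (Fib d)) (S : Fin (d + 1) → (Fin (d + 1) → ℤ) → MKer (d + 1) (Fib d))
    (κ : Fin (d + 1)) (u : Fin (d + 1) → ℤ) : mmRead N (comp (comp K (vertexOfK K N S κ u)) K) = -e3OfK N K S κ u := by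
  funext x z a b
  rw [Pi.neg_apply, Pi.neg_apply, Pi.neg_apply, Pi.neg_apply, e3OfK_apply, neg_neg]

/-- [folklore] The two-sided sandwich by a decaying kernel is ADDITIVE on bounded kernels (`comp_add_of_bdd`, `add_comp_of_bdd`, `bdd_comp_decays_bdd`). -/
theorem sandwich_add {K A B : MKer (d + 1) (Fib d)} {C δ BA BB : ℝ} (hK : Decays K C δ) (hδ : 0 < δ) (hA : Bdd A BA) (hB : Bdd B BB) :
    comp (comp K (A + B)) K = comp (comp K A) K + comp (comp K B) K := by
  rw [comp_add_of_bdd ⟨C, δ, hδ, hK⟩ hA hB, add_comp_of_bdd ⟨C, δ, hδ, hK⟩ (bdd_comp_decays_bdd hK hδ hA) (bdd_comp_decays_bdd hK hδ hB)]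

/-- [folklore] The two-sided sandwich is HOMOGENEOUS (`comp_smul_right`, `comp_smul_left`; unconditional). -/
theorem sandwich_smul (K A : MKer (d + 1) (Fib d)) (c : ℝ) : comp (comp K (c • A)) K = c • comp (comp K A) K := by
  rw [KernelReflection.comp_smul_right, KernelReflection.comp_smul_left]

/-- [folklore] `dM K N (A + B) M = vertexOfK K N A + dM K N B M` — the field-table slot of `dM` is additive (decaying `K`, bounded tables; `vertexOfK_add`). -/
theorem dM_add_left {K : MKer (d + 1) (Fib d)} (hK : ∃ δ C : ℝ, 0 < δ ∧ 0 ≤ C ∧ Decays K C δ) (N : ℕ)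
    {A B : Fin (d + 1) → (Fin (d + 1) → ℤ) → MKer (d + 1) (Fib d)} {BB : ℝ} (hA : ∀ κ u x z a b, |A κ u x z a b| ≤ BB)
    (hB : ∀ κ u x z a b, |B κ u x z a b| ≤ BB) (M : Fin (d + 1) → (Fin (d + 1) → ℤ) → MKer (d + 1) (Fib d))
    (μ : Fin (d + 1)) (y : Fin (d + 1) → ℤ) :
    dM K N (fun κ u => A κ u + B κ u) M μ y = vertexOfK K N A μ y + dM K N B M μ y := by
  unfold SecondOrderResponse.dM
  rw [vertexOfK_add (N := N) hK hA hB μ y, add_assoc]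

/-! ## §2 The transported block sum of a vertex-form residual is the block-summed S-step -/

/-- [folklore] **TRANSPORT OF A VERTEX-FORM RESIDUAL = BLOCK-SUMMED S-STEP + TRANSPORTED FIRST-ORDER PART.**  For a decaying `K`, a blocking `N`, any finite label
set `s`, and a residual family in VERTEX FORM `𝒩 y κ u = vertexOfK K N (Φ y) κ u + Ψ y κ u` with bounded `Φ`, `Ψ`:
`c • Σ_{v∈s} mmRead N (K ∘ 𝒩 (N•Y+v) κ u ∘ K) = Σ_{v∈s} (−c) • e3OfK N K (Φ (N•Y+v)) κ u + c • Σ_{v∈s} mmRead N (K ∘ Ψ (N•Y+v) κ u ∘ K)`.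
With `c := −(cH′·cE₂·wV4 (j+1)) = −(Lc^{d+1}·wE (j+1))` (part A's remainder, the lock) the first sum is LITERALLY the map of `SpineRooted.SpureRecAt_succ` applied to
`Φ (Lc•Y+v)`, summed over the fine blocks `v` of the coarse label `Y`. -/
theorem transport_vertexForm {K : MKer (d + 1) (Fib d)} {C δ : ℝ} (hK : Decays K C δ) (hδ : 0 < δ) (N : ℕ)
    {𝒩 Ψ : (Fin (d + 1) → ℤ) → Fin (d + 1) → (Fin (d + 1) → ℤ) → MKer (d + 1) (Fib d)}
    {Φ : (Fin (d + 1) → ℤ) → Fin (d + 1) → (Fin (d + 1) → ℤ) → MKer (d + 1) (Fib d)} {BΦ BΨ : ℝ}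
    (hΦ : ∀ y κ u x z a b, |Φ y κ u x z a b| ≤ BΦ) (hΨ : ∀ y κ u x z a b, |Ψ y κ u x z a b| ≤ BΨ)
    (h𝒩 : ∀ y κ u, 𝒩 y κ u = vertexOfK K N (Φ y) κ u + Ψ y κ u)
    (c : ℝ) (s : Finset (Fin (d + 1) → ℕ)) (Y : Fin (d + 1) → ℤ) (κ : Fin (d + 1)) (u : Fin (d + 1) → ℤ) :
    c • ∑ v ∈ s, mmRead N (comp (comp K (𝒩 ((N : ℤ) • Y + toSite v) κ u)) K) =
      ∑ v ∈ s, (-c) • e3OfK N K (Φ ((N : ℤ) • Y + toSite v)) κ u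
        + c • ∑ v ∈ s, mmRead N (comp (comp K (Ψ ((N : ℤ) • Y + toSite v) κ u)) K) := by
  have hV : ∀ y, Bdd (vertexOfK K N (Φ y) κ u) (((d + 1 : ℕ) : ℝ) * (C * ExpKernelCalculus.Zl (d + 1) δ * BΦ)) :=
    fun y x z a b => abs_vertexOfK_le hK hδ N (hΦ y) κ u x z a b
  have h1 : ∀ v ∈ s, mmRead N (comp (comp K (𝒩 ((N : ℤ) • Y + toSite v) κ u)) K) =
      -e3OfK N K (Φ ((N : ℤ) • Y + toSite v)) κ u + mmRead N (comp (comp K (Ψ ((N : ℤ) • Y + toSite v) κ u)) K) := by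
    intro v _
    rw [h𝒩, sandwich_add hK hδ (hV _) (fun x z a b => hΨ _ κ u x z a b), mmRead_add, mmRead_sandwich_vertexOfK]
  rw [Finset.sum_congr rfl h1, Finset.sum_add_distrib, smul_add, Finset.smul_sum]
  congr 1
  refine Finset.sum_congr rfl fun v _ => ?_
  rw [smul_neg, neg_smul]

/-! ## §3 The displayed residual shape of parts B ∕ C is a vertex of ONE table plus first-order data -/

/-- [folklore] **THE RESIDUAL SHAPE OF PARTS B∕C IN VERTEX FORM.**  For a decaying `K` and bounded tables `A`, `B₁`, `B₂` (the transported remainder and the two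
border-letter remainders) and any `M′`, `g`, `h` (the mixed-letter remainder, the gauge read, the rotated vertex):
`½ • ((dM K N (A + B₁) M′ μ y − g) + (dM K N (A + B₂) M′ μ y + h)) = vertexOfK K N (A + ½ • (B₁ + B₂)) μ y + (vertexOfM K N M′ μ y + ½ • (h − g))` —
the previous-level residual enters the next one ONLY through the `vertexOfK` slot, with the table `A + ½(B₁ + B₂)`. -/
theorem residual_eq_vertexForm {K : MKer (d + 1) (Fib d)} (hK : ∃ δ C : ℝ, 0 < δ ∧ 0 ≤ C ∧ Decays K C δ) (N : ℕ)
    {A B₁ B₂ : Fin (d + 1) → (Fin (d + 1) → ℤ) → MKer (d + 1) (Fib d)} {BA BB₁ BB₂ : ℝ}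
    (hA : ∀ κ u x z a b, |A κ u x z a b| ≤ BA) (hB₁ : ∀ κ u x z a b, |B₁ κ u x z a b| ≤ BB₁) (hB₂ : ∀ κ u x z a b, |B₂ κ u x z a b| ≤ BB₂)
    (M' : Fin (d + 1) → (Fin (d + 1) → ℤ) → MKer (d + 1) (Fib d)) (g h : MKer (d + 1) (Fib d)) (μ : Fin (d + 1)) (y : Fin (d + 1) → ℤ) :
    (1 / 2 : ℝ) • ((dM K N (fun κ u => A κ u + B₁ κ u) M' μ y - g) + (dM K N (fun κ u => A κ u + B₂ κ u) M' μ y + h)) =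
      vertexOfK K N (fun κ u => A κ u + (1 / 2 : ℝ) • (B₁ κ u + B₂ κ u)) μ y + (vertexOfM K N M' μ y + (1 / 2 : ℝ) • (h - g)) := by
  have hB : 0 ≤ max BB₁ BB₂ := ((abs_nonneg _).trans (hB₁ 0 0 0 0 (Sum.inl 0) (Sum.inl 0))).trans (le_max_left _ _)
  have hBA : 0 ≤ BA := (abs_nonneg _).trans (hA 0 0 0 0 (Sum.inl 0) (Sum.inl 0))
  -- bounds good enough for the additivity lemmas
  have hA' : ∀ κ u x z a b, |A κ u x z a b| ≤ BA + max BB₁ BB₂ := fun κ u x z a b => (hA κ u x z a b).trans (le_add_of_nonneg_right hB)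
  have hB₁' : ∀ κ u x z a b, |B₁ κ u x z a b| ≤ BA + max BB₁ BB₂ :=
    fun κ u x z a b => ((hB₁ κ u x z a b).trans (le_max_left _ _)).trans (le_add_of_nonneg_left hBA)
  have hB₂' : ∀ κ u x z a b, |B₂ κ u x z a b| ≤ BA + max BB₁ BB₂ :=
    fun κ u x z a b => ((hB₂ κ u x z a b).trans (le_max_right _ _)).trans (le_add_of_nonneg_left hBA)
  have hS' : ∀ κ u x z a b, |((1 / 2 : ℝ) • (B₁ κ u + B₂ κ u)) x z a b| ≤ BA + max BB₁ BB₂ := by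
    intro κ u x z a b
    rw [Pi.smul_apply, Pi.smul_apply, Pi.smul_apply, Pi.smul_apply, smul_eq_mul, Pi.add_apply, Pi.add_apply, Pi.add_apply, Pi.add_apply, abs_mul,
      abs_of_pos (by norm_num : (0 : ℝ) < 1 / 2)]
    have := abs_add_le (B₁ κ u x z a b) (B₂ κ u x z a b)
    have h1 := (hB₁ κ u x z a b).trans (le_max_left BB₁ BB₂)
    have h2 := (hB₂ κ u x z a b).trans (le_max_right BB₁ BB₂)
    nlinarith
  rw [dM_add_left hK N hA' hB₁' M' μ y, dM_add_left hK N hA' hB₂' M' μ y, vertexOfK_add (N := N) hK hA' hS' μ y]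
  unfold SecondOrderResponse.dM
  have e : vertexOfK K N (fun κ u => ((1 / 2 : ℝ) • (B₁ κ u + B₂ κ u))) μ y = (1 / 2 : ℝ) • (vertexOfK K N B₁ μ y + vertexOfK K N B₂ μ y) := by
    rw [← vertexOfK_add (N := N) hK hB₁' hB₂' μ y, ← vertexOfK_smul_table]
    rfl
  rw [e]
  funext x z a b
  simp only [Pi.add_apply, Pi.sub_apply, Pi.smul_apply, smul_eq_mul]
  ring

/-- [folklore] **THE LEVEL-0 RESIDUAL SHAPE IN VERTEX FORM** (no transported part): `½ • ((dM K N B₁ M′ μ y − g) + (dM K N B₂ M′ μ y + h)) =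
vertexOfK K N (½ • (B₁ + B₂)) μ y + (vertexOfM K N M′ μ y + ½ • (h − g))` — part C §1's level-0 residual (`B₁ = RW + RB₀`, `B₂ = RW″ + RB″₀`). -/
theorem residual_eq_vertexForm₀ {K : MKer (d + 1) (Fib d)} (hK : ∃ δ C : ℝ, 0 < δ ∧ 0 ≤ C ∧ Decays K C δ) (N : ℕ)
    {B₁ B₂ : Fin (d + 1) → (Fin (d + 1) → ℤ) → MKer (d + 1) (Fib d)} {BB₁ BB₂ : ℝ}
    (hB₁ : ∀ κ u x z a b, |B₁ κ u x z a b| ≤ BB₁) (hB₂ : ∀ κ u x z a b, |B₂ κ u x z a b| ≤ BB₂)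
    (M' : Fin (d + 1) → (Fin (d + 1) → ℤ) → MKer (d + 1) (Fib d)) (g h : MKer (d + 1) (Fib d)) (μ : Fin (d + 1)) (y : Fin (d + 1) → ℤ) :
    (1 / 2 : ℝ) • ((dM K N B₁ M' μ y - g) + (dM K N B₂ M' μ y + h)) =
      vertexOfK K N (fun κ u => (1 / 2 : ℝ) • (B₁ κ u + B₂ κ u)) μ y + (vertexOfM K N M' μ y + (1 / 2 : ℝ) • (h - g)) := by
  have hB₁' : ∀ κ u x z a b, |B₁ κ u x z a b| ≤ max BB₁ BB₂ := fun κ u x z a b => (hB₁ κ u x z a b).trans (le_max_left _ _)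
  have hB₂' : ∀ κ u x z a b, |B₂ κ u x z a b| ≤ max BB₁ BB₂ := fun κ u x z a b => (hB₂ κ u x z a b).trans (le_max_right _ _)
  have e : vertexOfK K N (fun κ u => ((1 / 2 : ℝ) • (B₁ κ u + B₂ κ u))) μ y = (1 / 2 : ℝ) • (vertexOfK K N B₁ μ y + vertexOfK K N B₂ μ y) := by
    rw [← vertexOfK_add (N := N) hK hB₁' hB₂' μ y, ← vertexOfK_smul_table]
    rfl
  rw [e]
  unfold SecondOrderResponse.dM
  funext x z a b
  simp only [Pi.add_apply, Pi.sub_apply, Pi.smul_apply, smul_eq_mul]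
  ring

/-! ## §4 The comb instances at the hW Ward pin: part A's table-law remainder in S-STEP FORM, part C's next residual in VERTEX FORM -/

section Comb

variable {Lc : ℕ} [NeZero Lc]

omit [NeZero Lc] in
/-- [folklore] The units lock without the common factor `½`: `cH′·(cE₂·wV4 (j+1)) = Lc^{d+1}·wE (j+1)`. -/
theorem lock_cancel {cH' cE₂ a b : ℝ} (hlock : cH' * (cE₂ * a) * ((1 : ℝ) / 2) = ((Lc : ℝ) ^ (d + 1) * b) * ((1 : ℝ) / 2)) :
    cH' * (cE₂ * a) = (Lc : ℝ) ^ (d + 1) * b :=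
  mul_right_cancel₀ (by norm_num : ((1 : ℝ) / 2) ≠ 0) hlock

/-- NOT IN PRINT; OUR BOOKKEEPING ([folklore] rewriting of leaf-06's part A §3 `WardLocusQuarticTable.tableLaw_T2RecAt_succ`, hypotheses VERBATIM plus the VERTEX FORM of
the level-`j` residual).  **THE LEVEL-(j+1) TABLE LAW OF `T2RecAt (j+1)` (FIRST SLOT) WITH ITS REMAINDER IN S-STEP FORM.**  At the hW Ward pin, in-block root
`ρ = toSite r`, `G_j = coDressKBmAt ρ Lc (KInvStep Lc j)`: if the level-`j` kernel-law residual has the vertex form `𝒩 y ν y′ = vertexOfK G_j Lc (Φ y) ν y′ + Ψ y ν y′`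
(bounded `Φ`, `Ψ`), then the `hS₂` law of `T2RecAt (j+1)` against `SpureRecAt (j+1)` holds with the remainder
`Σ_{v∈box} (Lc^{d+1}·wE (j+1)) • e3OfK Lc G_j (Φ (Lc•Y+v)) κ′u′ + (−(Lc^{d+1}·wE (j+1)) • Σ_v mmRead Lc (G_j ∘ Ψ (Lc•Y+v) κ′u′ ∘ G_j) + RB Y κ′u′)` —
the first summand is TOKEN FOR TOKEN the map of `SpineRooted.SpureRecAt_succ` (the S-STEP at `cE = Lc^{d+1}`) applied to `Φ (Lc•Y+v)` and summed over the
fine blocks of the coarse label `Y`. -/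
theorem tableLaw_T2RecAt_succ_sstep (hLc : 1 ≤ Lc) {r : Fin (d + 1) → ℕ} (hr : r ∈ box (d + 1) Lc) (cΛ cE₂ cB : ℝ)
    (T : Fin 4 → Fin 4 → Fin 4 → Fin 4 → ℝ)
    {vh₂S : Fin (d + 1) → (Fin (d + 1) → ℤ) → Fin (d + 1) → (Fin (d + 1) → ℤ) → MKer (d + 1) (Fib d)}
    (hB : ∃ C δ : ℝ, 0 < δ ∧ LocStencil₂ vh₂S C δ)
    {mixFF : Fin (d + 1) → (Fin (d + 1) → ℤ) → Fin (d + 1) → (Fin (d + 1) → ℤ) → MKer (d + 1) (Fib d)}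
    (hmix : ∃ C δ : ℝ, 0 < δ ∧ LocStencilFM Lc mixFF C δ) (j : ℕ)
    {𝒩 : (Fin (d + 1) → ℤ) → Fin (d + 1) → (Fin (d + 1) → ℤ) → MKer (d + 1) (Fib d)} (h𝒩 : ∀ y ν y', Loc (𝒩 y ν y'))
    (hWd : ∀ (y : Fin (d + 1) → ℤ) (ν : Fin (d + 1)) (y' : Fin (d + 1) → ℤ),
      divW (WrecAt d Lc (toSite r) ((Lc : ℝ) ^ (d + 1)) (-((Lc : ℝ) ^ (d + 1) * (1 / 2) * (Lc : ℝ) ^ (d + 1))) cΛ cE₂ cB T vh₂S mixFF j) y ν y' =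
        conjV (dM (coDressKBmAt (toSite r) Lc (KInvStep (d := d) Lc j)) Lc
            (SpureRecAt d Lc (toSite r) ((Lc : ℝ) ^ (d + 1)) (-((Lc : ℝ) ^ (d + 1) * (1 / 2) * (Lc : ℝ) ^ (d + 1))) cΛ j)
            (M1At d Lc (toSite r) cΛ j) ν y')
          (diagK (((1 : ℝ) / 2) • ∑ v ∈ box (d + 1) Lc, legInd (toSite r) ((Lc : ℤ) • y + toSite v))) + 𝒩 y ν y')
    -- NEW w.r.t. part A: the VERTEX FORM of the level-`j` residual (bounded table `Φ`, bounded first-order part `Ψ`)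
    {Φ : (Fin (d + 1) → ℤ) → Fin (d + 1) → (Fin (d + 1) → ℤ) → MKer (d + 1) (Fib d)}
    {Ψ : (Fin (d + 1) → ℤ) → Fin (d + 1) → (Fin (d + 1) → ℤ) → MKer (d + 1) (Fib d)} {BΦ BΨ : ℝ}
    (hΦ : ∀ y κ u x z a b, |Φ y κ u x z a b| ≤ BΦ) (hΨ : ∀ y κ u x z a b, |Ψ y κ u x z a b| ≤ BΨ)
    (h𝒩v : ∀ y ν y', 𝒩 y ν y' = vertexOfK (coDressKBmAt (toSite r) Lc (KInvStep (d := d) Lc j)) Lc (Φ y) ν y' + Ψ y ν y')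
    {cH' : ℝ} (hlock : cH' * (cE₂ * wV4 d Lc (j + 1)) * ((1 : ℝ) / 2) = ((Lc : ℝ) ^ (d + 1) * wE d Lc (j + 1)) * ((1 : ℝ) / 2))
    {RB : (Fin (d + 1) → ℤ) → Fin (d + 1) → (Fin (d + 1) → ℤ) → MKer (d + 1) (Fib d)}
    (hBord : ∀ (Y : Fin (d + 1) → ℤ) (κ' : Fin (d + 1)) (u' : Fin (d + 1) → ℤ),
      cH' • ∑ v ∈ box (d + 1) Lc, divV (fun κ u => (cB * wB2 d Lc (j + 1)) • vh₂S κ u κ' u') ((Lc : ℤ) • Y + toSite v) =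
        comp ((-((Lc : ℝ) ^ (d + 1) * (1 / 2) * (Lc : ℝ) ^ (d + 1)) * wVH d Lc (j + 1)) • vhSAt (toSite r) d Lc rfl κ' u')
            (diagK (((1 : ℝ) / 2) • ∑ v ∈ box (d + 1) Lc, legInd (toSite r) ((Lc : ℤ) • Y + toSite v)))
          - comp (diagK (((1 : ℝ) / 2) • ∑ v ∈ box (d + 1) Lc, legInd (toSite r) ((Lc : ℤ) • Y + toSite v)))
            ((-((Lc : ℝ) ^ (d + 1) * (1 / 2) * (Lc : ℝ) ^ (d + 1)) * wVH d Lc (j + 1)) • vhSAt (toSite r) d Lc rfl κ' u')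
          + RB Y κ' u')
    (Y : Fin (d + 1) → ℤ) (κ' : Fin (d + 1)) (u' : Fin (d + 1) → ℤ) :
    cH' • ∑ v ∈ box (d + 1) Lc, divV (fun κ u =>
        T2RecAt d Lc (toSite r) ((Lc : ℝ) ^ (d + 1)) (-((Lc : ℝ) ^ (d + 1) * (1 / 2) * (Lc : ℝ) ^ (d + 1))) cΛ cE₂ cB T vh₂S mixFF (j + 1) κ u κ' u')
        ((Lc : ℤ) • Y + toSite v) =
      comp (SpureRecAt d Lc (toSite r) ((Lc : ℝ) ^ (d + 1)) (-((Lc : ℝ) ^ (d + 1) * (1 / 2) * (Lc : ℝ) ^ (d + 1))) cΛ (j + 1) κ' u')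
          (diagK (((1 : ℝ) / 2) • ∑ v ∈ box (d + 1) Lc, legInd (toSite r) ((Lc : ℤ) • Y + toSite v)))
        - comp (diagK (((1 : ℝ) / 2) • ∑ v ∈ box (d + 1) Lc, legInd (toSite r) ((Lc : ℤ) • Y + toSite v)))
          (SpureRecAt d Lc (toSite r) ((Lc : ℝ) ^ (d + 1)) (-((Lc : ℝ) ^ (d + 1) * (1 / 2) * (Lc : ℝ) ^ (d + 1))) cΛ (j + 1) κ' u')
        + (∑ v ∈ box (d + 1) Lc, ((Lc : ℝ) ^ (d + 1) * wE d Lc (j + 1)) •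
              e3OfK Lc (coDressKBmAt (toSite r) Lc (KInvStep (d := d) Lc j)) (Φ ((Lc : ℤ) • Y + toSite v)) κ' u'
            + ((-((Lc : ℝ) ^ (d + 1) * wE d Lc (j + 1))) • ∑ v ∈ box (d + 1) Lc,
                mmRead Lc (comp (comp (coDressKBmAt (toSite r) Lc (KInvStep (d := d) Lc j)) (Ψ ((Lc : ℤ) • Y + toSite v) κ' u'))
                  (coDressKBmAt (toSite r) Lc (KInvStep (d := d) Lc j)))
              + RB Y κ' u')) := by
  obtain ⟨δK, CK, hδK, hCK, hKd⟩ := decays_coDressKBmAt_KInvStep (d := d) hr j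
  rw [tableLaw_T2RecAt_succ hLc hr cΛ cE₂ cB T hB hmix j h𝒩 hWd hlock hBord Y κ' u',
    transport_vertexForm hKd hδK Lc hΦ hΨ h𝒩v _ _ Y κ' u', neg_neg, lock_cancel hlock, add_assoc]


/-- NOT IN PRINT; OUR BOOKKEEPING ([folklore] rewriting of leaf-06's part C §2 `WardLocusRecursiveAll.divW_WrecAt_succ_of_kernelLaw`, hypotheses VERBATIM plus the VERTEX
FORM of the level-`j` residual).  **THE LEVEL-(j+1) WARD KERNEL LAW OF `WrecAt (j+1)` WITH ITS RESIDUAL IN VERTEX FORM — THE RECURSION CLOSES ON ONE TABLE.**  At the hW Ward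
pin (`cE₂ = Lc^{2(d+1)}`, in-block root): if the level-`j` residual is `𝒩 y = vertexOfK G_j Lc (Φ y) + Ψ y` (bounded `Φ`, `Ψ`), then the level-(j+1) residual of part C IS
`vertexOfK G_{j+1} Lc (Φ′ y) + Ψ′ y` with **`Φ′ y κ′u′ = Σ_{v∈box} (Lc^{d+1}·wE (j+1)) • e3OfK Lc G_j (Φ (Lc•y+v)) κ′u′ + σ y κ′u′`** — THE S-STEP of `SpineRooted.SpureRecAt_succ` with a
BLOCK-SUMMED PASSIVE LABEL — `σ y := −(Lc^{d+1}·wE (j+1)) • Σ_v mmRead Lc (G_j ∘ Ψ (Lc•y+v) ∘ G_j) + ½ • (RB y + RB″ y)`, and `Ψ′ y ν y′ := vertexOfM G_{j+1} Lc (RM y) ν y′ +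
½ • (rotated vertex − cH_{j+1} • gauge read)` = level-(j+1) FIRST-ORDER data and letters only (no previous-level object).  So the next level is again in vertex form, with
the new table `Φ′` obtained from `Φ` by the S-step: the Ward-locus residual tower IS the chain-rule vertex of an S-TOWER `Φ_j` with passive block label, driven by
explicit first-order sources — (Q-R) ⟺ j-uniform unit-currency rows of that S-tower ((Q-Φ)); nothing of it is bounded here. -/
theorem divW_WrecAt_succ_vertexForm (hLc : 1 ≤ Lc) {r : Fin (d + 1) → ℕ} (hr : r ∈ box (d + 1) Lc) (cΛ cB : ℝ) {cE₂ : ℝ}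
    (hcE₂ : cE₂ = (Lc : ℝ) ^ (2 * (d + 1))) (T : Fin 4 → Fin 4 → Fin 4 → Fin 4 → ℝ)
    {vh₂S : Fin (d + 1) → (Fin (d + 1) → ℤ) → Fin (d + 1) → (Fin (d + 1) → ℤ) → MKer (d + 1) (Fib d)}
    (hB : ∃ C δ : ℝ, 0 < δ ∧ LocStencil₂ vh₂S C δ)
    {mixFF : Fin (d + 1) → (Fin (d + 1) → ℤ) → Fin (d + 1) → (Fin (d + 1) → ℤ) → MKer (d + 1) (Fib d)}
    (hmix : ∃ C δ : ℝ, 0 < δ ∧ LocStencilFM Lc mixFF C δ) (j : ℕ)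
    -- the level-`j` kernel law (induction hypothesis) with its localised residual and the uniform bound of its transported sandwich
    {𝒩 : (Fin (d + 1) → ℤ) → Fin (d + 1) → (Fin (d + 1) → ℤ) → MKer (d + 1) (Fib d)} (h𝒩 : ∀ y ν y', Loc (𝒩 y ν y'))
    (hWd : ∀ (y : Fin (d + 1) → ℤ) (ν : Fin (d + 1)) (y' : Fin (d + 1) → ℤ),
      divW (WrecAt d Lc (toSite r) ((Lc : ℝ) ^ (d + 1)) (-((Lc : ℝ) ^ (d + 1) * (1 / 2) * (Lc : ℝ) ^ (d + 1))) cΛ cE₂ cB T vh₂S mixFF j) y ν y' =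
        conjV (dM (coDressKBmAt (toSite r) Lc (KInvStep (d := d) Lc j)) Lc
            (SpureRecAt d Lc (toSite r) ((Lc : ℝ) ^ (d + 1)) (-((Lc : ℝ) ^ (d + 1) * (1 / 2) * (Lc : ℝ) ^ (d + 1))) cΛ j)
            (M1At d Lc (toSite r) cΛ j) ν y')
          (diagK (((1 : ℝ) / 2) • ∑ v ∈ box (d + 1) Lc, legInd (toSite r) ((Lc : ℤ) • y + toSite v))) + 𝒩 y ν y')
    {B𝒩 B𝒩'' : ℝ}
    (h𝒩b : ∀ (Y : Fin (d + 1) → ℤ) (κ' : Fin (d + 1)) (u' : Fin (d + 1) → ℤ) x z a b,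
      |(∑ v ∈ box (d + 1) Lc, mmRead Lc (comp (comp (coDressKBmAt (toSite r) Lc (KInvStep (d := d) Lc j)) (𝒩 ((Lc : ℤ) • Y + toSite v) κ' u'))
        (coDressKBmAt (toSite r) Lc (KInvStep (d := d) Lc j)))) x z a b| ≤ B𝒩)
    (h𝒩b'' : ∀ (Y : Fin (d + 1) → ℤ) (κ : Fin (d + 1)) (u : Fin (d + 1) → ℤ) x z a b,
      |(∑ v ∈ box (d + 1) Lc, mmRead Lc (comp (comp (coDressKBmAt (toSite r) Lc (KInvStep (d := d) Lc j)) (𝒩 ((Lc : ℤ) • Y + toSite v) κ u))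
        (coDressKBmAt (toSite r) Lc (KInvStep (d := d) Lc j)))) x z a b| ≤ B𝒩'')
    -- the two level-(j+1) letters (an1's lane), bounded remainders
    {RB RB'' : (Fin (d + 1) → ℤ) → Fin (d + 1) → (Fin (d + 1) → ℤ) → MKer (d + 1) (Fib d)} {BB BB'' : ℝ}
    (hRBb : ∀ y κ u x z a b, |RB y κ u x z a b| ≤ BB) (hRB''b : ∀ y κ u x z a b, |RB'' y κ u x z a b| ≤ BB'')
    (hBord : ∀ (Y : Fin (d + 1) → ℤ) (κ' : Fin (d + 1)) (u' : Fin (d + 1) → ℤ),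
      (stepScale d Lc (j + 1) * (Lc : ℝ) ^ (d + 1))⁻¹ •
          ∑ v ∈ box (d + 1) Lc, divV (fun κ u => (cB * wB2 d Lc (j + 1)) • vh₂S κ u κ' u') ((Lc : ℤ) • Y + toSite v) =
        comp ((-((Lc : ℝ) ^ (d + 1) * (1 / 2) * (Lc : ℝ) ^ (d + 1)) * wVH d Lc (j + 1)) • vhSAt (toSite r) d Lc rfl κ' u')
            (diagK (((1 : ℝ) / 2) • ∑ v ∈ box (d + 1) Lc, legInd (toSite r) ((Lc : ℤ) • Y + toSite v)))
          - comp (diagK (((1 : ℝ) / 2) • ∑ v ∈ box (d + 1) Lc, legInd (toSite r) ((Lc : ℤ) • Y + toSite v)))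
            ((-((Lc : ℝ) ^ (d + 1) * (1 / 2) * (Lc : ℝ) ^ (d + 1)) * wVH d Lc (j + 1)) • vhSAt (toSite r) d Lc rfl κ' u')
          + RB Y κ' u')
    (hBord'' : ∀ (Y : Fin (d + 1) → ℤ) (κ : Fin (d + 1)) (u : Fin (d + 1) → ℤ),
      (stepScale d Lc (j + 1) * (Lc : ℝ) ^ (d + 1))⁻¹ •
          ∑ v ∈ box (d + 1) Lc, divV (fun κ' u' => (cB * wB2 d Lc (j + 1)) • vh₂S κ u κ' u') ((Lc : ℤ) • Y + toSite v) =
        comp ((-((Lc : ℝ) ^ (d + 1) * (1 / 2) * (Lc : ℝ) ^ (d + 1)) * wVH d Lc (j + 1)) • vhSAt (toSite r) d Lc rfl κ u)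
            (diagK (((1 : ℝ) / 2) • ∑ v ∈ box (d + 1) Lc, legInd (toSite r) ((Lc : ℤ) • Y + toSite v)))
          - comp (diagK (((1 : ℝ) / 2) • ∑ v ∈ box (d + 1) Lc, legInd (toSite r) ((Lc : ℤ) • Y + toSite v)))
            ((-((Lc : ℝ) ^ (d + 1) * (1 / 2) * (Lc : ℝ) ^ (d + 1)) * wVH d Lc (j + 1)) • vhSAt (toSite r) d Lc rfl κ u)
          + RB'' Y κ u)
    {RM : (Fin (d + 1) → ℤ) → Fin (d + 1) → (Fin (d + 1) → ℤ) → MKer (d + 1) (Fib d)} {BR' : ℝ}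
    (hRMb : ∀ y ρ w x z a b, |RM y ρ w x z a b| ≤ BR')
    (hM₂ : ∀ (y : Fin (d + 1) → ℤ) (ρ' : Fin (d + 1)) (w : Fin (d + 1) → ℤ),
      (stepScale d Lc (j + 1) * (Lc : ℝ) ^ (d + 1))⁻¹ •
          ∑ v ∈ box (d + 1) Lc, divV (fun κ u => M2Of d Lc mixFF (j + 1) κ u ρ' w) ((Lc : ℤ) • y + toSite v) =
        comp (M1At d Lc (toSite r) cΛ (j + 1) ρ' w) (diagK (((1 : ℝ) / 2) • ∑ v ∈ box (d + 1) Lc, legInd (toSite r) ((Lc : ℤ) • y + toSite v)))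
          - comp (diagK (((1 : ℝ) / 2) • ∑ v ∈ box (d + 1) Lc, legInd (toSite r) ((Lc : ℤ) • y + toSite v))) (M1At d Lc (toSite r) cΛ (j + 1) ρ' w)
          + RM y ρ' w)
    -- NEW w.r.t. part C: the VERTEX FORM of the level-`j` residual (bounded table `Φ`, bounded first-order part `Ψ`)
    {Φ : (Fin (d + 1) → ℤ) → Fin (d + 1) → (Fin (d + 1) → ℤ) → MKer (d + 1) (Fib d)}
    {Ψ : (Fin (d + 1) → ℤ) → Fin (d + 1) → (Fin (d + 1) → ℤ) → MKer (d + 1) (Fib d)} {BΦ BΨ : ℝ}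
    (hΦ : ∀ y κ u x z a b, |Φ y κ u x z a b| ≤ BΦ) (hΨ : ∀ y κ u x z a b, |Ψ y κ u x z a b| ≤ BΨ)
    (h𝒩v : ∀ y ν y', 𝒩 y ν y' = vertexOfK (coDressKBmAt (toSite r) Lc (KInvStep (d := d) Lc j)) Lc (Φ y) ν y' + Ψ y ν y')
    (y : Fin (d + 1) → ℤ) (ν : Fin (d + 1)) (y' : Fin (d + 1) → ℤ) :
    divW (WrecAt d Lc (toSite r) ((Lc : ℝ) ^ (d + 1)) (-((Lc : ℝ) ^ (d + 1) * (1 / 2) * (Lc : ℝ) ^ (d + 1))) cΛ cE₂ cB T vh₂S mixFF (j + 1)) y ν y' =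
      conjV (dM (coDressKBmAt (toSite r) Lc (KInvStep (d := d) Lc (j + 1))) Lc
            (SpureRecAt d Lc (toSite r) ((Lc : ℝ) ^ (d + 1)) (-((Lc : ℝ) ^ (d + 1) * (1 / 2) * (Lc : ℝ) ^ (d + 1))) cΛ (j + 1))
            (M1At d Lc (toSite r) cΛ (j + 1)) ν y')
          (diagK (((1 : ℝ) / 2) • ∑ v ∈ box (d + 1) Lc, legInd (toSite r) ((Lc : ℤ) • y + toSite v)))
        + (vertexOfK (coDressKBmAt (toSite r) Lc (KInvStep (d := d) Lc (j + 1))) Lc (fun κ' u' =>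
              ∑ v ∈ box (d + 1) Lc, ((Lc : ℝ) ^ (d + 1) * wE d Lc (j + 1)) •
                  e3OfK Lc (coDressKBmAt (toSite r) Lc (KInvStep (d := d) Lc j)) (Φ ((Lc : ℤ) • y + toSite v)) κ' u'
              + ((-((Lc : ℝ) ^ (d + 1) * wE d Lc (j + 1))) • ∑ v ∈ box (d + 1) Lc,
                    mmRead Lc (comp (comp (coDressKBmAt (toSite r) Lc (KInvStep (d := d) Lc j)) (Ψ ((Lc : ℤ) • y + toSite v) κ' u'))
                      (coDressKBmAt (toSite r) Lc (KInvStep (d := d) Lc j)))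
                + (1 / 2 : ℝ) • (RB y κ' u' + RB'' y κ' u'))) ν y'
          + (vertexOfM (coDressKBmAt (toSite r) Lc (KInvStep (d := d) Lc (j + 1))) Lc (RM y) ν y'
            + (1 / 2 : ℝ) • (dM (conjV (coDressKBmAt (toSite r) Lc (KInvStep (d := d) Lc (j + 1)))
                (diagK (((1 : ℝ) / 2) • ∑ v ∈ box (d + 1) Lc, legInd (toSite r) ((Lc : ℤ) • y + toSite v)))) Lc
              (SpureRecAt d Lc (toSite r) ((Lc : ℝ) ^ (d + 1)) (-((Lc : ℝ) ^ (d + 1) * (1 / 2) * (Lc : ℝ) ^ (d + 1))) cΛ (j + 1))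
              (M1At d Lc (toSite r) cΛ (j + 1)) ν y'
              - (stepScale d Lc (j + 1) * (Lc : ℝ) ^ (d + 1))⁻¹ • (∑ κ, wsum (fun u => ∑' x₂, ∑ κ₂,
                comp (coDressKBmAt (toSite r) Lc (KInvStep (d := d) Lc (j + 1)))
                  (dM (coDressKBmAt (toSite r) Lc (KInvStep (d := d) Lc (j + 1))) Lc
                    (SpureRecAt d Lc (toSite r) ((Lc : ℝ) ^ (d + 1)) (-((Lc : ℝ) ^ (d + 1) * (1 / 2) * (Lc : ℝ) ^ (d + 1))) cΛ (j + 1))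
                    (M1At d Lc (toSite r) cΛ (j + 1)) ν y') u x₂ (Sum.inl κ) (Sum.inl κ₂) * gaugeWt Lc y κ₂ x₂)
                (SpureRecAt d Lc (toSite r) ((Lc : ℝ) ^ (d + 1)) (-((Lc : ℝ) ^ (d + 1) * (1 / 2) * (Lc : ℝ) ^ (d + 1))) cΛ (j + 1) κ)
              + ∑ ρ', cwsum Lc (fun w => ∑' x₂, ∑ κ₂,
                comp (coDressKBmAt (toSite r) Lc (KInvStep (d := d) Lc (j + 1)))
                  (dM (coDressKBmAt (toSite r) Lc (KInvStep (d := d) Lc (j + 1))) Lc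
                    (SpureRecAt d Lc (toSite r) ((Lc : ℝ) ^ (d + 1)) (-((Lc : ℝ) ^ (d + 1) * (1 / 2) * (Lc : ℝ) ^ (d + 1))) cΛ (j + 1))
                    (M1At d Lc (toSite r) cΛ (j + 1)) ν y') ((Lc : ℤ) • w) x₂ (Sum.inr ρ') (Sum.inl κ₂) * gaugeWt Lc y κ₂ x₂)
                (M1At d Lc (toSite r) cΛ (j + 1) ρ'))))) := by
  obtain ⟨δ0, C0, hδ0, hC0, hK0⟩ := decays_coDressKBmAt_KInvStep (d := d) hr j
  have hK1 := decays_coDressKBmAt_KInvStep (d := d) hr (j + 1)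
  rw [divW_WrecAt_succ_of_kernelLaw hLc hr cΛ cB hcE₂ T hB hmix j h𝒩 hWd h𝒩b h𝒩b'' hRBb hRB''b hBord hBord'' hRMb hM₂ y ν y']
  congr 1
  -- the displayed residual of part C IS `vertexOfK G_{j+1} (A + ½(RB + RB″)) + (vertexOfM G_{j+1} RM + ½(rot − gauge))`, `A` = the transported remainder
  have hA : ∀ κ' u' x z a b, |(-((stepScale d Lc (j + 1) * (Lc : ℝ) ^ (d + 1))⁻¹ * (cE₂ * wV4 d Lc (j + 1))) •
      ∑ v ∈ box (d + 1) Lc, mmRead Lc (comp (comp (coDressKBmAt (toSite r) Lc (KInvStep (d := d) Lc j))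
        (𝒩 ((Lc : ℤ) • y + toSite v) κ' u')) (coDressKBmAt (toSite r) Lc (KInvStep (d := d) Lc j)))) x z a b| ≤
      |(-((stepScale d Lc (j + 1) * (Lc : ℝ) ^ (d + 1))⁻¹ * (cE₂ * wV4 d Lc (j + 1))))| * B𝒩 := by
    intro κ' u' x z a b
    rw [Pi.smul_apply, Pi.smul_apply, Pi.smul_apply, Pi.smul_apply, smul_eq_mul, abs_mul]
    exact mul_le_mul_of_nonneg_left (h𝒩b y κ' u' x z a b) (abs_nonneg _)
  refine (residual_eq_vertexForm hK1 Lc hA (hRBb y) (hRB''b y) (RM y) _ _ ν y').trans ?_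
  -- … and `A` is the block-summed S-step of `Φ` plus the sandwich of `Ψ` (§2 + the lock)
  have eA : (fun κ' u' => -((stepScale d Lc (j + 1) * (Lc : ℝ) ^ (d + 1))⁻¹ * (cE₂ * wV4 d Lc (j + 1))) •
        ∑ v ∈ box (d + 1) Lc, mmRead Lc (comp (comp (coDressKBmAt (toSite r) Lc (KInvStep (d := d) Lc j))
          (𝒩 ((Lc : ℤ) • y + toSite v) κ' u')) (coDressKBmAt (toSite r) Lc (KInvStep (d := d) Lc j)))
        + (1 / 2 : ℝ) • (RB y κ' u' + RB'' y κ' u')) = fun κ' u' =>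
      ∑ v ∈ box (d + 1) Lc, ((Lc : ℝ) ^ (d + 1) * wE d Lc (j + 1)) •
          e3OfK Lc (coDressKBmAt (toSite r) Lc (KInvStep (d := d) Lc j)) (Φ ((Lc : ℤ) • y + toSite v)) κ' u'
        + ((-((Lc : ℝ) ^ (d + 1) * wE d Lc (j + 1))) • ∑ v ∈ box (d + 1) Lc,
              mmRead Lc (comp (comp (coDressKBmAt (toSite r) Lc (KInvStep (d := d) Lc j)) (Ψ ((Lc : ℤ) • y + toSite v) κ' u'))
                (coDressKBmAt (toSite r) Lc (KInvStep (d := d) Lc j)))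
          + (1 / 2 : ℝ) • (RB y κ' u' + RB'' y κ' u')) := by
    funext κ' u'
    rw [transport_vertexForm hK0 hδ0 Lc hΦ hΨ h𝒩v _ _ y κ' u', neg_neg, lock_cancel (lock_succ_of_pin (d := d) hLc hcE₂ j), add_assoc]
  rw [eA]

end Comb

end Summit.QuantumFields.BalabanUV.Beta.GAN24.WardResidualSRecursion

end
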